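import Mathlib
import HarnessLib
import Literature.Geometry.DiscreteGeometry.BondGraph
import Literature.Geometry.DiscreteGeometry.KissingPatterns
import Summits.AtomisticToContinuum.Crystallization.Theorems.PricedLinkCensusSoftLayerPropagationH1RSolve

/-!
# The frame lemma (crux `SoftLayerPropagation`, line `Sketch`, stub `develop_H1R`)

Route `PricedLinkCensus`, crux `SoftLayerPropagation` (stmt-AtomisticToContinuum-14233), line `Sketch`.
Helper file for the registered stub `develop_H1R` (metric ordered caps): the three diagonals
`n₁, n₂, n₃` of the anchor octahedron are a near-orthogonal frame (`Theorems.metric_octahedron_sharp`: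
`1.955 ≤ ‖nᵢ‖² ≤ 2.167`, `|⟪nᵢ, nⱼ⟫| ≤ 0.0214`), so the coordinates `Xᵢ = ⟪E, nᵢ⟫` of any vector `E`
satisfy `1.9 ‖E‖² ≤ Σ Xᵢ² ≤ 2.21 ‖E‖²` (`h1r_frame`).  Lower bound: the quadratic solving lemma
`Theorems.solve_sq` for the unit vectors `nᵢ/‖nᵢ‖`; upper bound: Cauchy–Schwarz against
`Σ Xᵢ nᵢ`.  All `[folklore]`.
-/

noncomputable section

namespace Summit.AtomisticToContinuum.Crystallization.Theorems

open Literature.Geometry.DiscreteGeometry RealInnerProductSpace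

/-- A vector with `‖n‖² ≥ g > 0` has positive norm. [folklore] -/
theorem norm_pos_of_sq_ge {n : EuclideanSpace ℝ (Fin 3)} {g : ℝ} (hg : 0 < g) (hn : g ≤ ‖n‖ ^ 2) :
    0 < ‖n‖ := by
  by_contra h
  push Not at h
  have h0 : ‖n‖ = 0 := le_antisymm h (norm_nonneg _)
  rw [h0] at hn
  norm_num at hn
  linarith

/-- Two normalised vectors of a near-orthogonal frame are near-orthogonal. [folklore] -/
theorem abs_inner_unit_le {n m : EuclideanSpace ℝ (Fin 3)} {g β : ℝ} (hg : 0 < g)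
    (hn : g ≤ ‖n‖ ^ 2) (hm : g ≤ ‖m‖ ^ 2) (h : |inner ℝ n m| ≤ β) (hβ : 0 ≤ β) :
    |inner ℝ (‖n‖⁻¹ • n) (‖m‖⁻¹ • m)| ≤ β / g := by
  have hn0 : 0 < ‖n‖ := norm_pos_of_sq_ge hg hn
  have hm0 : 0 < ‖m‖ := norm_pos_of_sq_ge hg hm
  rw [real_inner_smul_left, real_inner_smul_right, ← mul_assoc, abs_mul, abs_mul,
    abs_of_pos (inv_pos.2 hn0), abs_of_pos (inv_pos.2 hm0), ← mul_inv, inv_mul_eq_div]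
  have hprod : g ≤ ‖n‖ * ‖m‖ := by
    have h1 : g ^ 2 ≤ (‖n‖ * ‖m‖) ^ 2 := by
      rw [mul_pow, pow_two]; exact mul_le_mul hn hm hg.le (sq_nonneg _)
    exact (pow_le_pow_iff_left₀ hg.le (by positivity) two_ne_zero).1 h1
  rw [div_le_div_iff₀ (by positivity) hg]
  calc |inner ℝ n m| * g ≤ β * g := mul_le_mul_of_nonneg_right h hg.le
    _ ≤ β * (‖n‖ * ‖m‖) := mul_le_mul_of_nonneg_left hprod hβ

/-- The squared coordinate against a normalised vector, times `‖n‖²`, is the squared coordinate.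
[folklore] -/
theorem sq_inner_unit_mul {E n : EuclideanSpace ℝ (Fin 3)} (hn : 0 < ‖n‖) :
    |inner ℝ E (‖n‖⁻¹ • n)| ^ 2 * ‖n‖ ^ 2 = inner ℝ E n ^ 2 := by
  rw [sq_abs, real_inner_smul_right, mul_pow, inv_pow]
  field_simp

set_option maxHeartbeats 800000 in
/-- **The frame lemma (`h1r_frame`).**  For a near-orthogonal frame with the Gram bounds delivered by
`Theorems.metric_octahedron_sharp` at `α = 77/1250`, `β = 107/5000`, the coordinates of any vector `E`
satisfy `19/10 ‖E‖² ≤ Σ ⟪E, nᵢ⟫² ≤ 221/100 ‖E‖²`. [folklore] -/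
theorem h1r_frame : ∀ (E n₁ n₂ n₃ : EuclideanSpace ℝ (Fin 3)), 2 - 2 * (107 / 5000 : ℝ) - 4 * (107 / 5000 : ℝ) ^ 2 ≤ ‖n₁‖ ^ 2 → ‖n₁‖ ^ 2 ≤ 2 + 2 * (77 / 1250 : ℝ) + 2 * (107 / 5000 : ℝ) + 2 * (107 / 5000 : ℝ) ^ 2 → 2 - 2 * (107 / 5000 : ℝ) - 4 * (107 / 5000 : ℝ) ^ 2 ≤ ‖n₂‖ ^ 2 → ‖n₂‖ ^ 2 ≤ 2 + 2 * (77 / 1250 : ℝ) + 2 * (107 / 5000 : ℝ) + 2 * (107 / 5000 : ℝ) ^ 2 → 2 - 2 * (107 / 5000 : ℝ) - 4 * (107 / 5000 : ℝ) ^ 2 ≤ ‖n₃‖ ^ 2 → ‖n₃‖ ^ 2 ≤ 2 + 2 * (77 / 1250 : ℝ) + 2 * (107 / 5000 : ℝ) + 2 * (107 / 5000 : ℝ) ^ 2 → |inner ℝ n₁ n₂| ≤ (107 / 5000 : ℝ) → |inner ℝ n₂ n₃| ≤ (107 / 5000 : ℝ) → |inner ℝ n₃ n₁| ≤ (107 /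 5000 : ℝ) → (19 / 10 : ℝ) * ‖E‖ ^ 2 ≤ inner ℝ E n₁ ^ 2 + inner ℝ E n₂ ^ 2 + inner ℝ E n₃ ^ 2 ∧ inner ℝ E n₁ ^ 2 + inner ℝ E n₂ ^ 2 + inner ℝ E n₃ ^ 2 ≤ (221 / 100 : ℝ) * ‖E‖ ^ 2 := by
  intro E n₁ n₂ n₃ h1 h1' h2 h2' h3 h3' h12 h23 h31
  have h13 : |inner ℝ n₁ n₃| ≤ (107 / 5000 : ℝ) := by rwa [real_inner_comm] at h31
  set g : ℝ := 2 - 2 * (107 / 5000 : ℝ) - 4 * (107 / 5000 : ℝ) ^ 2 with hg_def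
  have hg : (0 : ℝ) < g := by rw [hg_def]; norm_num
  have hgv : g = 12221051 / 6250000 := by rw [hg_def]; norm_num
  set c₁ := inner ℝ E n₁ with hc₁
  set c₂ := inner ℝ E n₂ with hc₂
  set c₃ := inner ℝ E n₃ with hc₃
  constructor
  · -- lower bound via `solve_sq` on the normalised frame
    have p1 := norm_pos_of_sq_ge hg h1
    have p2 := norm_pos_of_sq_ge hg h2
    have p3 := norm_pos_of_sq_ge hg h3
    have u1 : (1 : ℝ) ≤ ‖‖n₁‖⁻¹ • n₁‖ := by rw [norm_smul, Real.norm_eq_abs, abs_of_pos (inv_pos.2 p1), inv_mul_cancel₀ p1.ne']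
    have u2 : (1 : ℝ) ≤ ‖‖n₂‖⁻¹ • n₂‖ := by rw [norm_smul, Real.norm_eq_abs, abs_of_pos (inv_pos.2 p2), inv_mul_cancel₀ p2.ne']
    have u3 : (1 : ℝ) ≤ ‖‖n₃‖⁻¹ • n₃‖ := by rw [norm_smul, Real.norm_eq_abs, abs_of_pos (inv_pos.2 p3), inv_mul_cancel₀ p3.ne']
    have hβ : (0 : ℝ) ≤ 107 / 5000 := by norm_num
    have hγg : (107 / 5000 : ℝ) / g ≤ 11 / 1000 := by rw [hgv]; norm_num
    have g12 : |inner ℝ (‖n₁‖⁻¹ • n₁) (‖n₂‖⁻¹ • n₂)| ≤ 11 / 1000 := (abs_inner_unit_le hg h1 h2 h12 hβ).trans hγg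
    have g13 : |inner ℝ (‖n₁‖⁻¹ • n₁) (‖n₃‖⁻¹ • n₃)| ≤ 11 / 1000 := (abs_inner_unit_le hg h1 h3 h13 hβ).trans hγg
    have g23 : |inner ℝ (‖n₂‖⁻¹ • n₂) (‖n₃‖⁻¹ • n₃)| ≤ 11 / 1000 := (abs_inner_unit_le hg h2 h3 h23 hβ).trans hγg
    set b₁ := |inner ℝ E (‖n₁‖⁻¹ • n₁)| with hb₁
    set b₂ := |inner ℝ E (‖n₂‖⁻¹ • n₂)| with hb₂
    set b₃ := |inner ℝ E (‖n₃‖⁻¹ • n₃)| with hb₃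
    have T := @solve_sq 1 1 1 (11 / 1000) b₁ b₂ b₃ one_pos one_pos one_pos (by norm_num) (abs_nonneg _)
      (abs_nonneg _) (abs_nonneg _) E _ _ _ u1 u2 u3 g12 g13 g23 (le_refl b₁) (le_refl b₂) (le_refl b₃)
    have T' : ‖E‖ ^ 2 * (499817169 / 500000000 : ℝ) ≤
        b₁ ^ 2 + b₂ ^ 2 + b₃ ^ 2 + (11121 / 500000 : ℝ) * (b₁ * b₂) + (11121 / 500000 : ℝ) * (b₁ * b₃) + (11121 / 500000 : ℝ) * (b₂ * b₃) := by
      linear_combination T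
    have x12 : 2 * (b₁ * b₂) ≤ b₁ ^ 2 + b₂ ^ 2 := by linarith [two_mul_le_add_sq b₁ b₂]
    have x13 : 2 * (b₁ * b₃) ≤ b₁ ^ 2 + b₃ ^ 2 := by linarith [two_mul_le_add_sq b₁ b₃]
    have x23 : 2 * (b₂ * b₃) ≤ b₂ ^ 2 + b₃ ^ 2 := by linarith [two_mul_le_add_sq b₂ b₃]
    have e1 : b₁ ^ 2 * ‖n₁‖ ^ 2 = c₁ ^ 2 := by rw [hb₁, hc₁]; exact sq_inner_unit_mul p1
    have e2 : b₂ ^ 2 * ‖n₂‖ ^ 2 = c₂ ^ 2 := by rw [hb₂, hc₂]; exact sq_inner_unit_mul p2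
    have e3 : b₃ ^ 2 * ‖n₃‖ ^ 2 = c₃ ^ 2 := by rw [hb₃, hc₃]; exact sq_inner_unit_mul p3
    have f1 : g * b₁ ^ 2 ≤ c₁ ^ 2 := by rw [← e1, mul_comm]; exact mul_le_mul_of_nonneg_left h1 (sq_nonneg _)
    have f2 : g * b₂ ^ 2 ≤ c₂ ^ 2 := by rw [← e2, mul_comm]; exact mul_le_mul_of_nonneg_left h2 (sq_nonneg _)
    have f3 : g * b₃ ^ 2 ≤ c₃ ^ 2 := by rw [← e3, mul_comm]; exact mul_le_mul_of_nonneg_left h3 (sq_nonneg _)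
    rw [hgv] at f1 f2 f3
    have step1 : ‖E‖ ^ 2 * (499817169 / 500000000 : ℝ) ≤ (511121 / 500000 : ℝ) * b₁ ^ 2 + (511121 / 500000 : ℝ) * b₂ ^ 2 + (511121 / 500000 : ℝ) * b₃ ^ 2 := by
      linarith [T', x12, x13, x23]
    linarith only [step1, f1, f2, f3, sq_nonneg c₁, sq_nonneg c₂, sq_nonneg c₃, sq_nonneg b₁, sq_nonneg b₂, sq_nonneg b₃]
  · -- upper bound via Cauchy–Schwarz against `W = Σ cᵢ nᵢ`
    set W : EuclideanSpace ℝ (Fin 3) := c₁ • n₁ + c₂ • n₂ + c₃ • n₃ with hW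
    have hEW : inner ℝ E W = c₁ ^ 2 + c₂ ^ 2 + c₃ ^ 2 := by
      rw [hW, inner_add_right, inner_add_right, real_inner_smul_right, real_inner_smul_right,
        real_inner_smul_right, ← hc₁, ← hc₂, ← hc₃]; ring
    have hWW : ‖W‖ ^ 2 = c₁ ^ 2 * ‖n₁‖ ^ 2 + c₂ ^ 2 * ‖n₂‖ ^ 2 + c₃ ^ 2 * ‖n₃‖ ^ 2 +
        2 * (c₁ * c₂) * inner ℝ n₁ n₂ + 2 * (c₁ * c₃) * inner ℝ n₁ n₃ + 2 * (c₂ * c₃) * inner ℝ n₂ n₃ := by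
      rw [hW]
      simp only [Literature.Algebra.EuclideanLattices.inner_fin_three,
        Literature.Algebra.EuclideanLattices.norm_sq_fin_three, PiLp.add_apply, PiLp.smul_apply, smul_eq_mul]
      ring
    set S := c₁ ^ 2 + c₂ ^ 2 + c₃ ^ 2 with hS
    have hS0 : 0 ≤ S := by positivity
    have hcross : 2 * (c₁ * c₂) * inner ℝ n₁ n₂ + 2 * (c₁ * c₃) * inner ℝ n₁ n₃ + 2 * (c₂ * c₃) * inner ℝ n₂ n₃ ≤
        2 * (107 / 5000 : ℝ) * S := by
      have e12 : (c₁ * c₂) * inner ℝ n₁ n₂ ≤ |c₁ * c₂| * (107 / 5000 : ℝ) := by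
        calc (c₁ * c₂) * inner ℝ n₁ n₂ ≤ |(c₁ * c₂) * inner ℝ n₁ n₂| := le_abs_self _
          _ = |c₁ * c₂| * |inner ℝ n₁ n₂| := abs_mul _ _
          _ ≤ |c₁ * c₂| * (107 / 5000 : ℝ) := mul_le_mul_of_nonneg_left h12 (abs_nonneg _)
      have e13 : (c₁ * c₃) * inner ℝ n₁ n₃ ≤ |c₁ * c₃| * (107 / 5000 : ℝ) := by
        calc (c₁ * c₃) * inner ℝ n₁ n₃ ≤ |(c₁ * c₃) * inner ℝ n₁ n₃| := le_abs_self _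
          _ = |c₁ * c₃| * |inner ℝ n₁ n₃| := abs_mul _ _
          _ ≤ |c₁ * c₃| * (107 / 5000 : ℝ) := mul_le_mul_of_nonneg_left h13 (abs_nonneg _)
      have e23 : (c₂ * c₃) * inner ℝ n₂ n₃ ≤ |c₂ * c₃| * (107 / 5000 : ℝ) := by
        calc (c₂ * c₃) * inner ℝ n₂ n₃ ≤ |(c₂ * c₃) * inner ℝ n₂ n₃| := le_abs_self _
          _ = |c₂ * c₃| * |inner ℝ n₂ n₃| := abs_mul _ _
          _ ≤ |c₂ * c₃| * (107 / 5000 : ℝ) := mul_le_mul_of_nonneg_left h23 (abs_nonneg _)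
      have b12 : 2 * |c₁ * c₂| ≤ c₁ ^ 2 + c₂ ^ 2 := by
        have h0 := two_mul_le_add_sq |c₁| |c₂|
        rw [sq_abs, sq_abs] at h0
        rw [abs_mul]; linarith [h0]
      have b13 : 2 * |c₁ * c₃| ≤ c₁ ^ 2 + c₃ ^ 2 := by
        have h0 := two_mul_le_add_sq |c₁| |c₃|
        rw [sq_abs, sq_abs] at h0
        rw [abs_mul]; linarith [h0]
      have b23 : 2 * |c₂ * c₃| ≤ c₂ ^ 2 + c₃ ^ 2 := by
        have h0 := two_mul_le_add_sq |c₂| |c₃|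
        rw [sq_abs, sq_abs] at h0
        rw [abs_mul]; linarith [h0]
      rw [hS]; linarith
    have hWle : ‖W‖ ^ 2 ≤ (221 / 100 : ℝ) * S := by
      rw [hWW]
      have t1 : c₁ ^ 2 * ‖n₁‖ ^ 2 ≤ c₁ ^ 2 * (2 + 2 * (77 / 1250 : ℝ) + 2 * (107 / 5000 : ℝ) + 2 * (107 / 5000 : ℝ) ^ 2) :=
        mul_le_mul_of_nonneg_left h1' (sq_nonneg _)
      have t2 : c₂ ^ 2 * ‖n₂‖ ^ 2 ≤ c₂ ^ 2 * (2 + 2 * (77 / 1250 : ℝ) + 2 * (107 / 5000 : ℝ) + 2 * (107 / 5000 : ℝ) ^ 2) :=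
        mul_le_mul_of_nonneg_left h2' (sq_nonneg _)
      have t3 : c₃ ^ 2 * ‖n₃‖ ^ 2 ≤ c₃ ^ 2 * (2 + 2 * (77 / 1250 : ℝ) + 2 * (107 / 5000 : ℝ) + 2 * (107 / 5000 : ℝ) ^ 2) :=
        mul_le_mul_of_nonneg_left h3' (sq_nonneg _)
      rw [hS] at hcross ⊢; linarith [t1, t2, t3, hcross]
    have cs : inner ℝ E W ≤ ‖E‖ * ‖W‖ := real_inner_le_norm _ _
    rw [hEW] at cs
    by_cases hS1 : S = 0
    · rw [hS1]; positivity
    have hSpos : 0 < S := lt_of_le_of_ne hS0 (Ne.symm hS1)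
    have cs2 : S ^ 2 ≤ ‖E‖ ^ 2 * ‖W‖ ^ 2 := by
      rw [← mul_pow]; exact pow_le_pow_left₀ hS0 cs 2
    have h4 : S ^ 2 ≤ ‖E‖ ^ 2 * ((221 / 100 : ℝ) * S) := cs2.trans (mul_le_mul_of_nonneg_left hWle (sq_nonneg _))
    have h5 : S * S ≤ ((221 / 100 : ℝ) * ‖E‖ ^ 2) * S := by rw [← pow_two]; linarith [h4]
    exact le_of_mul_le_mul_right h5 hSpos

end Summit.AtomisticToContinuum.Crystallization.Theorems

end
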